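import Mathlib.ModelTheory.Satisfiability
import Mathlib.Order.Zorn
import Mathlib.Data.Fintype.Quotient
import Literature.ModelTheory.ProofTheory.HilbertCalculus

/-!
# Gödel's completeness theorem for the Hilbert calculus on pre-sentences

Support file for the proof of the enumerability theorem
(`FirstOrder.Language.Theory.IsComputablyAxiomatizable.isRE`; Enderton, *A Mathematical
Introduction to Logic*, §2.5). For a first-order language `L` with encodable symbols, a Mathlib
theory `T : L.Theory` and a sentence `φ`, we prove

`Provable (ofBounded '' T) (ofBounded φ) ↔ T ⊨ᵇ φ`

(`Literature.ModelTheory.ProofTheory.PreFOL.provable_iff_models`), where `Provable`/`Derives` is the Hilbert calculus of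
`Literature/ModelTheory/ProofTheory/HilbertCalculus.lean` and `ofBounded` the translation of
`Literature/ModelTheory/ProofTheory/PreSemantics.lean`. The direction `→` is soundness; the
direction `←` is Gödel's completeness theorem, proved by Henkin's method following Enderton §2.5
step by step:

* Step 2 (`henkinSet`): to a consistent set `S` of parameter-free pre-sentences add, for the
  `n`-th pre-formula `φₙ` of an enumeration, the Henkin axiom `¬∀φₙ → ¬φₙ[cₙ]` with a parameter
  `cₙ` fresh for `φ₀, …, φₙ` and `c₀, …, cₙ₋₁`; consistency is preserved by generalisation on
  constants (`consistent_henkinSet`). (Step 1, adding the constants, is built into the calculus: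
  parameters are part of the pre-syntax.)
* Step 3 (`exists_maximal`): Lindenbaum's lemma by Zorn; maximal consistent sets are deductively
  closed, decide every sentence, respect `→`, and — thanks to the Henkin axioms — contain `∀ψ` iff
  they contain every closed instance `ψ[s]` (`MaxCons.all_mem_iff`).
* Steps 4–5 (`TermModel`): the quotient of the closed well-formed pre-terms by provable equality
  is an `L`-structure (congruence from the equality axioms `E1`, `E2`).
* Truth lemma (`MaxCons.mem_iff_realize`) by induction on the formula, closing instances with
  `close`; Step 6: the term model satisfies `S`, and Mathlib's `Theory.Model.isSatisfiable`
  (Löwenheim–Skolem transfer between universes) turns it into `¬ T ⊨ᵇ φ`.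

## Main statements

* `Literature.ModelTheory.ProofTheory.PreFOL.provable_iff_models` — soundness and completeness of the calculus with respect to
  Mathlib's semantic consequence `T ⊨ᵇ φ`. [cite: Enderton2001, §2.5 Completeness Theorem (Gödel 1930)]

## References

* H. B. Enderton, *A Mathematical Introduction to Logic*, Academic Press (1972 / 2nd ed. 2001),
  §2.5, Completeness Theorem and its proof (Steps 1–6), Thm. 24F (generalization on constants).
* L. Henkin, *The completeness of the first-order functional calculus*, JSL 14 (1949).
-/

namespace Literature.ModelTheory.ProofTheory.PreFOL

open FirstOrder FirstOrder.Language FirstOrder.Language.Structure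

open PreFormula

/-! ### Step 2: the Henkin set -/

section Henkin

/-- A fixed enumeration of all pre-formulas. [folklore] -/
noncomputable def enumFormula : ℕ → PreFormula :=
  Classical.choose (exists_surjective_nat PreFormula)

/-- The enumeration of pre-formulas is surjective. [folklore] -/
theorem enumFormula_surjective : Function.Surjective enumFormula :=
  Classical.choose_spec (exists_surjective_nat PreFormula)

/-- A strict bound for the parameters of the first `n + 1` enumerated formulas. [folklore] -/
noncomputable def paramBound : ℕ → ℕ
  | 0 => (enumFormula 0).params.sup id + 1
  | n + 1 => paramBound n + (enumFormula (n + 1)).params.sup id + 1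

/-- `paramBound` is monotone. [folklore] -/
theorem paramBound_mono {m n : ℕ} (h : m ≤ n) : paramBound m ≤ paramBound n := by
  induction h with
  | refl => exact le_rfl
  | step _ ih => exact ih.trans (by simp [paramBound]; omega)

/-- Every parameter of `φₘ`, `m ≤ n`, is below `paramBound n`. [folklore] -/
theorem lt_paramBound {m n c : ℕ} (h : m ≤ n) (hc : c ∈ (enumFormula m).params) :
    c < paramBound n := by
  refine lt_of_lt_of_le ?_ (paramBound_mono h)
  have : c ≤ (enumFormula m).params.sup id := Finset.le_sup (f := id) hc
  cases m with
  | zero => simp [paramBound]; omega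
  | succ m => simp [paramBound]; omega

/-- The `n`-th Henkin constant: fresh for `φ₀, …, φₙ`, and injective in `n`. [folklore] -/
noncomputable def henkinConst (n : ℕ) : ℕ := Nat.pair (paramBound n) n

/-- Henkin constants are injective. [folklore] -/
theorem henkinConst_injective : Function.Injective henkinConst := by
  intro m n h
  have := congrArg (fun p => (Nat.unpair p).2) h
  simpa [henkinConst, Nat.unpair_pair] using this

/-- The `n`-th Henkin constant does not occur in `φₘ` for `m ≤ n`. [folklore] -/
theorem henkinConst_notMem {m n : ℕ} (h : m ≤ n) : henkinConst n ∉ (enumFormula m).params := by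
  intro hc
  have h1 := lt_paramBound h hc
  have h2 : paramBound n ≤ henkinConst n := Nat.left_le_pair _ _
  omega

/-- The `n`-th Henkin axiom `¬∀φₙ → ¬φₙ[cₙ]` (Enderton §2.5, Step 2). [folklore] -/
noncomputable def henkinAxiom (n : ℕ) : PreFormula :=
  imp (not (all (enumFormula n)))
    (not ((enumFormula n).inst 0 (PreTerm.param (henkinConst n))))

/-- Parameters of a Henkin axiom. [folklore] -/
theorem mem_params_henkinAxiom {n c : ℕ} (h : c ∈ (henkinAxiom n).params) :
    c ∈ (enumFormula n).params ∨ c = henkinConst n := by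
  simp only [henkinAxiom, params, Finset.mem_union, Finset.notMem_empty, or_false] at h
  rcases h with h | h
  · exact Or.inl h
  · have := params_inst_subset 0 (PreTerm.param (henkinConst n)) _ h
    simp only [Finset.mem_union, PreTerm.params, Finset.mem_singleton] at this
    exact this

/-- A later Henkin constant does not occur in an earlier Henkin axiom. [folklore] -/
theorem henkinConst_notMem_henkinAxiom {m n : ℕ} (h : m < n) :
    henkinConst n ∉ (henkinAxiom m).params := by
  intro hc
  rcases mem_params_henkinAxiom hc with h' | h'
  · exact henkinConst_notMem h.le h'
  · exact absurd (henkinConst_injective h') (Nat.ne_of_gt h)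

/-- The Henkin set of a set `S` of pre-sentences: `S` together with all Henkin axioms. [folklore] -/
def henkinSet (S : Set PreFormula) : Set PreFormula :=
  S ∪ Set.range henkinAxiom

/-- The `n`-th stage: `S` together with the first `n` Henkin axioms. [folklore] -/
def henkinStage (S : Set PreFormula) (n : ℕ) : Set PreFormula :=
  S ∪ henkinAxiom '' {m | m < n}

/-- Stages are consistent (Enderton §2.5, Step 2, "details"): an inconsistency at stage `n + 1`
yields `¬θₙ` from stage `n`, hence `¬∀φₙ` and `φₙ[cₙ]`; generalisation on the fresh constant
`cₙ` gives `∀φₙ`, contradicting the consistency of stage `n`. [folklore] -/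
theorem consistent_henkinStage {S : Set PreFormula} (hS : Consistent S)
    (hS0 : ∀ ψ ∈ S, ψ.params = ∅) : ∀ n, Consistent (henkinStage S n)
  | 0 => by
      have : henkinStage S 0 = S := by simp [henkinStage]
      rwa [this]
  | n + 1 => by
      intro hinc
      have ih := consistent_henkinStage hS hS0 n
      have hst : henkinStage S (n + 1) = insert (henkinAxiom n) (henkinStage S n) := by
        ext ψ
        simp only [henkinStage, Set.mem_union, Set.mem_image, Set.mem_setOf_eq, Set.mem_insert_iff]
        constructor
        · rintro (h | ⟨m, hm, rfl⟩)
          · exact Or.inr (Or.inl h)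
          · rcases Nat.lt_succ_iff_lt_or_eq.1 hm with hm | rfl
            · exact Or.inr (Or.inr ⟨m, hm, rfl⟩)
            · exact Or.inl rfl
        · rintro (rfl | h | ⟨m, hm, rfl⟩)
          · exact Or.inr ⟨n, Nat.lt_succ_self n, rfl⟩
          · exact Or.inl h
          · exact Or.inr ⟨m, Nat.lt_succ_of_lt hm, rfl⟩
      rw [hst] at hinc
      have hnot : Provable (henkinStage S n) (not (henkinAxiom n)) :=
        Consistent.provable_not_of_inconsistent_insert (fun h => h hinc)
      obtain ⟨U, hU, hd⟩ := hnot
      have h1 : Derives U (not (all (enumFormula n))) := Derives.left_of_not_imp hd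
      have h2 : Derives U ((enumFormula n).inst 0 (PreTerm.param (henkinConst n))) :=
        Derives.mp₀ (Derives.p3 _) (Derives.not_right_of_not_imp hd)
      have h3 : Derives U (all (enumFormula n)) := by
        refine Derives.gen h2 (henkinConst_notMem le_rfl) fun ψ hψ => ?_
        rcases hU ψ hψ with h | ⟨m, hm, rfl⟩
        · simp [hS0 ψ h]
        · exact henkinConst_notMem_henkinAxiom hm
      exact ih ⟨U ++ U, by
        intro ψ hψ
        rcases List.mem_append.1 hψ with hψ | hψ <;> exact hU ψ hψ, Derives.mp h1 h3⟩

/-- Finitely many members of the Henkin set lie in a finite stage. [folklore] -/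
theorem exists_henkinStage (S : Set PreFormula) :
    ∀ U : List PreFormula, (∀ ψ ∈ U, ψ ∈ henkinSet S) → ∃ n, ∀ ψ ∈ U, ψ ∈ henkinStage S n
  | [], _ => ⟨0, by simp⟩
  | χ :: U, hU => by
      obtain ⟨n, hn⟩ := exists_henkinStage S U (fun ψ hψ => hU ψ (List.mem_cons_of_mem _ hψ))
      rcases hU χ (by simp) with h | ⟨m, rfl⟩
      · refine ⟨n, fun ψ hψ => ?_⟩
        rcases List.mem_cons.1 hψ with rfl | hψ
        · exact Or.inl h
        · exact hn ψ hψ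
      · refine ⟨max n (m + 1), fun ψ hψ => ?_⟩
        rcases List.mem_cons.1 hψ with rfl | hψ
        · exact Or.inr ⟨m, show m < max n (m + 1) by omega, rfl⟩
        · rcases hn ψ hψ with h | ⟨m', hm', rfl⟩
          · exact Or.inl h
          · exact Or.inr ⟨m', show m' < max n (m + 1) from lt_of_lt_of_le hm' (le_max_left _ _), rfl⟩

/-- The Henkin set of a consistent set of parameter-free pre-sentences is consistent
(a derivation uses finitely many Henkin axioms). [folklore] -/
theorem consistent_henkinSet {S : Set PreFormula} (hS : Consistent S)
    (hS0 : ∀ ψ ∈ S, ψ.params = ∅) : Consistent (henkinSet S) := by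
  rintro ⟨U, hU, hd⟩
  obtain ⟨n, hn⟩ := exists_henkinStage S U hU
  exact consistent_henkinStage hS hS0 n ⟨U, hn, hd⟩

end Henkin

/-! ### Step 3: maximal consistent sets -/

/-- Finitely many members of the union of a nonempty chain lie in one member. [folklore] -/
theorem exists_mem_chain {c : Set (Set PreFormula)} (hchain : IsChain (· ⊆ ·) c) {s₀ : Set PreFormula}
    (hs₀ : s₀ ∈ c) : ∀ U : List PreFormula, (∀ ψ ∈ U, ψ ∈ ⋃₀ c) → ∃ s ∈ c, ∀ ψ ∈ U, ψ ∈ s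
  | [], _ => ⟨s₀, hs₀, by simp⟩
  | χ :: U, hU => by
      obtain ⟨s, hs, hsU⟩ := exists_mem_chain hchain hs₀ U
        (fun ψ hψ => hU ψ (List.mem_cons_of_mem _ hψ))
      obtain ⟨t, ht, hχt⟩ := Set.mem_sUnion.1 (hU χ (by simp))
      by_cases hst_eq : s = t
      · subst hst_eq
        exact ⟨s, hs, fun ψ hψ => by
          rcases List.mem_cons.1 hψ with rfl | hψ
          · exact hχt
          · exact hsU ψ hψ⟩
      rcases hchain hs ht hst_eq with hst | hts
      · exact ⟨t, ht, fun ψ hψ => by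
          rcases List.mem_cons.1 hψ with rfl | hψ
          · exact hχt
          · exact hst (hsU ψ hψ)⟩
      · exact ⟨s, hs, fun ψ hψ => by
          rcases List.mem_cons.1 hψ with rfl | hψ
          · exact hts hχt
          · exact hsU ψ hψ⟩

/-- Lindenbaum's lemma (Enderton §2.5, Step 3): a consistent set extends to a maximal consistent
one. [folklore] -/
theorem exists_maximal {H : Set PreFormula} (hH : Consistent H) :
    ∃ Δ : Set PreFormula, H ⊆ Δ ∧ Consistent Δ ∧ ∀ Δ', Consistent Δ' → Δ ⊆ Δ' → Δ' = Δ := by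
  obtain ⟨Δ, hHΔ, hmax⟩ := zorn_subset_nonempty {Δ : Set PreFormula | Consistent Δ}
    (fun c hc hchain hne => by
      obtain ⟨s₀, hs₀⟩ := hne
      refine ⟨⋃₀ c, ?_, fun s hs => Set.subset_sUnion_of_mem hs⟩
      rintro ⟨U, hU, hd⟩
      obtain ⟨s, hs, hsU⟩ := exists_mem_chain hchain hs₀ U hU
      exact (hc hs : Consistent s) ⟨U, hsU, hd⟩)
    H hH
  exact ⟨Δ, hHΔ, hmax.prop, fun Δ' hΔ' hΔΔ' => (hmax.eq_of_subset hΔ' hΔΔ').symm⟩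

/-- A *maximal consistent Henkin set*: consistent, maximal among consistent sets, and containing
all Henkin axioms. [folklore] -/
structure MaxCons (Δ : Set PreFormula) : Prop where
  /-- `Δ` is consistent. -/
  consistent : Consistent Δ
  /-- `Δ` is maximal among consistent sets. -/
  maximal : ∀ Δ', Consistent Δ' → Δ ⊆ Δ' → Δ' = Δ
  /-- `Δ` contains every Henkin axiom. -/
  henkin : ∀ n, henkinAxiom n ∈ Δ

namespace MaxCons

variable {Δ : Set PreFormula} (hΔ : MaxCons Δ)
include hΔ

/-- Maximal consistent sets are deductively closed. [folklore] -/
theorem mem_of_provable {φ : PreFormula} (h : Provable Δ φ) : φ ∈ Δ := by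
  have : insert φ Δ = Δ := by
    refine hΔ.maximal _ ?_ (Set.subset_insert _ _)
    intro hinc
    exact hΔ.consistent ((Consistent.provable_not_of_inconsistent_insert fun h' => h' hinc).mp h)
  rw [← this]
  exact Set.mem_insert _ _

/-- Maximal consistent sets decide every pre-sentence. [folklore] -/
theorem mem_or_not_mem (φ : PreFormula) : φ ∈ Δ ∨ not φ ∈ Δ := by
  by_cases h : φ ∈ Δ
  · exact Or.inl h
  · right
    refine hΔ.mem_of_provable (Consistent.provable_not_of_inconsistent_insert fun hc => h ?_)
    rw [← hΔ.maximal _ hc (Set.subset_insert _ _)]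
    exact Set.mem_insert _ _

/-- `⊥` is not in a maximal consistent set. [folklore] -/
theorem falsum_notMem : falsum ∉ Δ := fun h => hΔ.consistent (Provable.of_mem h)

/-- A maximal consistent set does not contain both `φ` and `¬φ`. [folklore] -/
theorem not_mem_imp {φ : PreFormula} (h : not φ ∈ Δ) : φ ∉ Δ := fun h' =>
  hΔ.falsum_notMem (hΔ.mem_of_provable ((Provable.of_mem h).mp (Provable.of_mem h')))

/-- Implications in a maximal consistent set. [folklore] -/
theorem imp_mem_iff {φ ψ : PreFormula} : imp φ ψ ∈ Δ ↔ (φ ∈ Δ → ψ ∈ Δ) := by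
  constructor
  · intro h hφ
    exact hΔ.mem_of_provable ((Provable.of_mem h).mp (Provable.of_mem hφ))
  · intro h
    rcases hΔ.mem_or_not_mem φ with hφ | hφ
    · exact hΔ.mem_of_provable ((Provable.of_derives (Derives.p1 ψ φ)).mp (Provable.of_mem (h hφ)))
    · exact hΔ.mem_of_provable ((Provable.of_derives (Derives.not_imp φ ψ)).mp (Provable.of_mem hφ))

/-- Universal sentences in a maximal consistent Henkin set: `∀ψ ∈ Δ` iff every instance by a term
from a class of closed terms containing the parameters is in `Δ` (Enderton §2.5, Steps 2–4). [folklore] -/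
theorem all_mem_iff {ψ : PreFormula} (P : PreTerm → Prop) (hP : ∀ s, P s → s.closedTerm = true)
    (hparam : ∀ c, P (PreTerm.param c)) :
    all ψ ∈ Δ ↔ ∀ s, P s → ψ.inst 0 s ∈ Δ := by
  constructor
  · intro h s hs
    exact hΔ.mem_of_provable ((Provable.of_derives (Derives.q1 ψ (hP s hs))).mp (Provable.of_mem h))
  · intro h
    by_contra hall
    obtain ⟨n, hn⟩ := enumFormula_surjective ψ
    have hna : not (all ψ) ∈ Δ := (hΔ.mem_or_not_mem _).resolve_left hall
    have hax := hΔ.henkin n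
    rw [henkinAxiom, hn] at hax
    have := hΔ.imp_mem_iff.1 hax hna
    exact hΔ.not_mem_imp this (h _ (hparam _))

/-- Provable equality is symmetric in a maximal consistent set. [folklore] -/
theorem equal_symm {s t : PreTerm} (hs : s.closedTerm = true) (ht : t.closedTerm = true)
    (h : equal s t ∈ Δ) : equal t s ∈ Δ := by
  -- E2 with the context `x = s`: from `s = t` and `s = s` infer `t = s`
  have e2 := Derives.e2 (equal (PreTerm.var 0) s) hs ht
  simp only [PreFormula.inst, PreTerm.inst, lt_self_iff_false, ↓reduceIte,
    PreTerm.inst_of_closed 0 _ (PreTerm.closed_of_closedTerm hs)] at e2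
  exact hΔ.mem_of_provable (((Provable.of_derives e2).mp (Provable.of_mem h)).mp
    (Provable.of_derives (Derives.e1 s)))

/-- Replacement of provably equal closed terms in a one-hole context (axiom `E2`). [folklore] -/
theorem inst_mem_of_equal_mem {s t : PreTerm} (hs : s.closedTerm = true) (ht : t.closedTerm = true)
    (h : equal s t ∈ Δ) (φ : PreFormula) (hφ : φ.inst 0 s ∈ Δ) : φ.inst 0 t ∈ Δ :=
  hΔ.mem_of_provable (((Provable.of_derives (Derives.e2 φ hs ht)).mp (Provable.of_mem h)).mp
    (Provable.of_mem hφ))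

/-- Congruence of provable equality under a one-hole term context `C` (a pre-term whose only
variable is level `0`, used via `inst 0`). [folklore] -/
theorem ctx_congr {s t : PreTerm} (hs : s.closedTerm = true) (ht : t.closedTerm = true)
    (h : equal s t ∈ Δ) (C : PreTerm) (hC : ∀ u : PreTerm, u.closed = true → (C.inst 0 u).closed = true) :
    equal (C.inst 0 s) (C.inst 0 t) ∈ Δ := by
  have hCs : (C.inst 0 s).closed = true := hC s (PreTerm.closed_of_closedTerm hs)
  have := hΔ.inst_mem_of_equal_mem hs ht h (equal (C.inst 0 s) C) (by
    simp only [PreFormula.inst, PreTerm.inst_of_closed 0 s hCs]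
    exact hΔ.mem_of_provable (Provable.of_derives (Derives.e1 _)))
  simpa only [PreFormula.inst, PreTerm.inst_of_closed 0 t hCs] using this

/-- Provable equality is transitive in a maximal consistent set. [folklore] -/
theorem equal_trans {s t u : PreTerm} (hs : s.closedTerm = true) (ht : t.closedTerm = true)
    (hu : u.closedTerm = true) (h₁ : equal s t ∈ Δ) (h₂ : equal t u ∈ Δ) : equal s u ∈ Δ := by
  have := hΔ.inst_mem_of_equal_mem ht hu h₂ (equal s (PreTerm.var 0))
  simp only [PreFormula.inst, PreTerm.inst, lt_self_iff_false, ↓reduceIte,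
    PreTerm.inst_of_closed 0 _ (PreTerm.closed_of_closedTerm hs)] at this
  exact this h₁

/-- Provable equality is reflexive. [folklore] -/
theorem equal_refl (t : PreTerm) : equal t t ∈ Δ :=
  hΔ.mem_of_provable (Provable.of_derives (Derives.e1 t))

end MaxCons

/-! ### Steps 4–5: congruence and the term model -/

namespace PreTerm

/-- The family `g` with the entries below `j` replaced by those of `g'`. [folklore] -/
def mixed {n : ℕ} (g g' : Fin n → PreTerm) (j : ℕ) : Fin n → PreTerm :=
  fun i => if i.val < j then g' i else g i

/-- The family `mixed g g' j` with a hole (level `0`) at position `j`. [folklore] -/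
def holed {n : ℕ} (g g' : Fin n → PreTerm) (j : ℕ) : Fin n → PreTerm :=
  fun i => if i.val < j then g' i else if i.val = j then var 0 else g i

/-- `mixed g g' 0 = g`. [folklore] -/
theorem mixed_zero {n : ℕ} (g g' : Fin n → PreTerm) : mixed g g' 0 = g := by
  funext i; simp [mixed]

/-- `mixed g g' n = g'`. [folklore] -/
theorem mixed_self {n : ℕ} (g g' : Fin n → PreTerm) : mixed g g' n = g' := by
  funext i; simp [mixed, i.2]

/-- Filling the hole with `g j` gives `mixed g g' j`. [folklore] -/
theorem holed_inst_left {n : ℕ} {g g' : Fin n → PreTerm} (hg : ∀ i, (g i).closed = true)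
    (hg' : ∀ i, (g' i).closed = true) {j : ℕ} (hj : j < n) :
    (ofFn (holed g g' j)).inst 0 (g ⟨j, hj⟩) = ofFn (mixed g g' j) := by
  rw [inst_ofFn]
  congr 1
  funext i
  unfold holed mixed
  by_cases h1 : i.val < j
  · simp [h1, inst_of_closed 0 _ (hg' i)]
  · by_cases h2 : i.val = j
    · have : i = ⟨j, hj⟩ := Fin.ext h2
      subst this
      simp [inst]
    · simp [h1, h2, inst_of_closed 0 _ (hg i)]

/-- Filling the hole with `g' j` gives `mixed g g' (j + 1)`. [folklore] -/
theorem holed_inst_right {n : ℕ} {g g' : Fin n → PreTerm} (hg : ∀ i, (g i).closed = true)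
    (hg' : ∀ i, (g' i).closed = true) {j : ℕ} (hj : j < n) :
    (ofFn (holed g g' j)).inst 0 (g' ⟨j, hj⟩) = ofFn (mixed g g' (j + 1)) := by
  rw [inst_ofFn]
  congr 1
  funext i
  unfold holed mixed
  by_cases h1 : i.val < j
  · have : i.val < j + 1 := by omega
    simp [h1, this, inst_of_closed 0 _ (hg' i)]
  · by_cases h2 : i.val = j
    · have : i = ⟨j, hj⟩ := Fin.ext h2
      subst this
      simp [inst]
    · have : ¬ i.val < j + 1 := by omega
      simp [h1, h2, this, inst_of_closed 0 _ (hg i)]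

/-- Filling the hole with any closed term gives a closed list. [folklore] -/
theorem closed_holed_inst {n : ℕ} {g g' : Fin n → PreTerm} (hg : ∀ i, (g i).closed = true)
    (hg' : ∀ i, (g' i).closed = true) (j : ℕ) {u : PreTerm} (hu : u.closed = true) :
    ((ofFn (holed g g' j)).inst 0 u).closed = true := by
  rw [inst_ofFn]
  refine closed_ofFn _ fun i => ?_
  unfold holed
  split_ifs
  · rw [inst_of_closed 0 _ (hg' i)]; exact hg' i
  · simpa [inst] using hu
  · rw [inst_of_closed 0 _ (hg i)]; exact hg i

/-- Entries of `mixed` are closed. [folklore] -/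
theorem closed_mixed {n : ℕ} {g g' : Fin n → PreTerm} (hg : ∀ i, (g i).closed = true)
    (hg' : ∀ i, (g' i).closed = true) (j : ℕ) (i : Fin n) : (mixed g g' j i).closed = true := by
  unfold mixed; split_ifs; exacts [hg' i, hg i]

end PreTerm

namespace MaxCons

variable {Δ : Set PreFormula} (hΔ : MaxCons Δ)
include hΔ

/-- Congruence of provable equality under function symbols (Enderton §2.5, Step 5 (ii)). [folklore] -/
theorem func_congr (f : ℕ) {n : ℕ} {g g' : Fin n → PreTerm} (hg : ∀ i, (g i).closedTerm = true)
    (hg' : ∀ i, (g' i).closedTerm = true) (h : ∀ i, equal (g i) (g' i) ∈ Δ) :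
    equal (PreTerm.func f (PreTerm.ofFn g)) (PreTerm.func f (PreTerm.ofFn g')) ∈ Δ := by
  have hgc : ∀ i, (g i).closed = true := fun i => PreTerm.closed_of_closedTerm (hg i)
  have hgc' : ∀ i, (g' i).closed = true := fun i => PreTerm.closed_of_closedTerm (hg' i)
  have hcl : ∀ j, (PreTerm.func f (PreTerm.ofFn (PreTerm.mixed g g' j))).closedTerm = true := fun j =>
    by simpa [PreTerm.closedTerm] using PreTerm.closed_ofFn _ (PreTerm.closed_mixed hgc hgc' j)
  have key : ∀ j, j ≤ n → equal (PreTerm.func f (PreTerm.ofFn g))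
      (PreTerm.func f (PreTerm.ofFn (PreTerm.mixed g g' j))) ∈ Δ := by
    intro j
    induction j with
    | zero => intro; rw [PreTerm.mixed_zero]; exact hΔ.equal_refl _
    | succ j ih =>
        intro hj
        have hj' : j < n := hj
        have step := hΔ.ctx_congr (hg ⟨j, hj'⟩) (hg' ⟨j, hj'⟩) (h ⟨j, hj'⟩)
          (PreTerm.func f (PreTerm.ofFn (PreTerm.holed g g' j)))
          (fun u hu => by simpa [PreTerm.inst, PreTerm.closed] using PreTerm.closed_holed_inst hgc hgc' j hu)
        simp only [PreTerm.inst, PreTerm.holed_inst_left hgc hgc' hj',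
          PreTerm.holed_inst_right hgc hgc' hj'] at step
        have h0 : (PreTerm.func f (PreTerm.ofFn g)).closedTerm = true := by
          simpa [PreTerm.mixed_zero] using hcl 0
        exact hΔ.equal_trans h0 (hcl j) (hcl (j + 1)) (ih hj'.le) step
  simpa [PreTerm.mixed_self] using key n le_rfl

/-- Congruence of provable atomic relations (Enderton §2.5, Step 5 (iii)). [folklore] -/
theorem rel_congr (r : ℕ) {n : ℕ} {g g' : Fin n → PreTerm} (hg : ∀ i, (g i).closedTerm = true)
    (hg' : ∀ i, (g' i).closedTerm = true) (h : ∀ i, equal (g i) (g' i) ∈ Δ)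
    (hr : rel r (PreTerm.ofFn g) ∈ Δ) : rel r (PreTerm.ofFn g') ∈ Δ := by
  have hgc : ∀ i, (g i).closed = true := fun i => PreTerm.closed_of_closedTerm (hg i)
  have hgc' : ∀ i, (g' i).closed = true := fun i => PreTerm.closed_of_closedTerm (hg' i)
  have key : ∀ j, j ≤ n → rel r (PreTerm.ofFn (PreTerm.mixed g g' j)) ∈ Δ := by
    intro j
    induction j with
    | zero => intro; rw [PreTerm.mixed_zero]; exact hr
    | succ j ih =>
        intro hj
        have hj' : j < n := hj
        have step := hΔ.inst_mem_of_equal_mem (hg ⟨j, hj'⟩) (hg' ⟨j, hj'⟩) (h ⟨j, hj'⟩)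
          (rel r (PreTerm.ofFn (PreTerm.holed g g' j)))
        simp only [PreFormula.inst, PreTerm.holed_inst_left hgc hgc' hj',
          PreTerm.holed_inst_right hgc hgc' hj'] at step
        exact step (ih hj'.le)
  simpa [PreTerm.mixed_self] using key n le_rfl

end MaxCons

section TermModel

variable {L : Language} [Encodable (Σ i, L.Functions i)] [Encodable (Σ i, L.Relations i)]
variable {Δ : Set PreFormula}

/-- The closed well-formed pre-terms of `L` (with parameters): the carrier of the term structure
of Enderton §2.5, Step 4, before the quotient. [folklore] -/
def ClosedTerm (L : Language) [Encodable (Σ i, L.Functions i)] (_hΔ : MaxCons Δ) : Type :=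
  {t : PreTerm // t.Wf (arityF L) 0 none}

/-- Provable equality of closed terms, an equivalence relation by `E1`, `E2` (Enderton §2.5,
Step 5 (i)). [folklore] -/
instance termSetoid (hΔ : MaxCons Δ) : Setoid (ClosedTerm L hΔ) where
  r s t := equal s.1 t.1 ∈ Δ
  iseqv :=
    { refl := fun s => hΔ.equal_refl s.1
      symm := fun {s t} h => hΔ.equal_symm s.2.closedTerm_of_zero t.2.closedTerm_of_zero h
      trans := fun {s t u} h₁ h₂ =>
        hΔ.equal_trans s.2.closedTerm_of_zero t.2.closedTerm_of_zero u.2.closedTerm_of_zero h₁ h₂ }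

/-- The **term model**: closed well-formed pre-terms modulo provable equality (Enderton §2.5,
Steps 4–5, the structure `𝔄/E`). [folklore] -/
def TermModel (hΔ : MaxCons Δ) : Type := Quotient (termSetoid (L := L) hΔ)

variable (hΔ : MaxCons Δ)

/-- The class of a closed well-formed pre-term. [folklore] -/
def TermModel.mk (t : PreTerm) (h : t.Wf (arityF L) 0 none) : TermModel (L := L) hΔ :=
  Quotient.mk (termSetoid hΔ) ⟨t, h⟩

/-- The term model is nonempty: it contains the class of the parameter `param 0`. [folklore] -/
instance : Nonempty (TermModel (L := L) hΔ) := ⟨TermModel.mk hΔ (PreTerm.param 0) (PreTerm.Wf.param 0)⟩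

omit [Encodable (Σ i, L.Relations i)] in
/-- Two classes are equal iff the terms are provably equal. [folklore] -/
theorem TermModel.mk_eq_mk {s t : PreTerm} {hs : s.Wf (arityF L) 0 none} {ht : t.Wf (arityF L) 0 none} :
    TermModel.mk hΔ s hs = TermModel.mk hΔ t ht ↔ equal s t ∈ Δ :=
  Quotient.eq (r := termSetoid hΔ)

omit [Encodable (Σ i, L.Relations i)] in
/-- Every element of the term model is the class of a closed well-formed term. [folklore] -/
theorem TermModel.exists_mk (a : TermModel (L := L) hΔ) : ∃ t h, TermModel.mk hΔ t h = a := by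
  induction a using Quotient.ind with
  | _ t => exact ⟨t.1, t.2, rfl⟩

/-- A representative of a class. [folklore] -/
noncomputable def TermModel.rep (a : TermModel (L := L) hΔ) : ClosedTerm L hΔ :=
  Quotient.out (s := termSetoid hΔ) a

omit [Encodable (Σ i, L.Relations i)] in
/-- The class of the representative. [folklore] -/
theorem TermModel.mk_rep (a : TermModel (L := L) hΔ) : TermModel.mk hΔ (a.rep hΔ).1 (a.rep hΔ).2 = a :=
  Quotient.out_eq (s := termSetoid hΔ) a

omit [Encodable (Σ i, L.Relations i)] in
/-- The representative of a class is provably equal to any of its members. [folklore] -/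
theorem TermModel.rep_mk_equal (t : PreTerm) (h : t.Wf (arityF L) 0 none) :
    equal ((TermModel.mk hΔ t h).rep hΔ).1 t ∈ Δ :=
  Quotient.mk_out (s := termSetoid hΔ) ⟨t, h⟩

/-- The term model as an `L`-structure: symbols act on representatives (Enderton §2.5, Step 4
(b)–(c) and Step 5). [folklore] -/
noncomputable instance TermModel.instStructure : L.Structure (TermModel (L := L) hΔ) where
  funMap {n} F xs :=
    TermModel.mk hΔ
      (PreTerm.func (Encodable.encode (⟨n, F⟩ : Σ i, L.Functions i))
        (PreTerm.ofFn fun i => ((xs i).rep hΔ).1))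
      (PreTerm.Wf.func (arityF_encode F) (PreTerm.Wf.ofFn fun i => ((xs i).rep hΔ).2))
  RelMap {n} R xs :=
    rel (Encodable.encode (⟨n, R⟩ : Σ i, L.Relations i)) (PreTerm.ofFn fun i => ((xs i).rep hΔ).1) ∈ Δ

/-- The canonical parameter assignment of the term model: `c ↦ [param c]`. [folklore] -/
def TermModel.κ : ℕ → TermModel (L := L) hΔ := fun c => TermModel.mk hΔ (PreTerm.param c) (PreTerm.Wf.param c)

/-- `funMap` on classes of closed terms is the class of the applied term. [folklore] -/
theorem TermModel.funMap_mk {n : ℕ} (F : L.Functions n) (g : Fin n → PreTerm)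
    (hg : ∀ i, (g i).Wf (arityF L) 0 none) :
    Structure.funMap (M := TermModel hΔ) F (fun i => TermModel.mk hΔ (g i) (hg i)) =
      TermModel.mk hΔ (PreTerm.func (Encodable.encode (⟨n, F⟩ : Σ i, L.Functions i)) (PreTerm.ofFn g))
        (PreTerm.Wf.func (arityF_encode F) (PreTerm.Wf.ofFn hg)) := by
  show TermModel.mk hΔ _ _ = _
  rw [TermModel.mk_eq_mk]
  exact hΔ.func_congr _ (fun i => (((TermModel.mk hΔ (g i) (hg i)).rep hΔ).2).closedTerm_of_zero)
    (fun i => (hg i).closedTerm_of_zero) (fun i => TermModel.rep_mk_equal hΔ (g i) (hg i))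

/-- `RelMap` on classes of closed terms is membership of the atomic sentence. [folklore] -/
theorem TermModel.relMap_mk {n : ℕ} (R : L.Relations n) (g : Fin n → PreTerm)
    (hg : ∀ i, (g i).Wf (arityF L) 0 none) :
    Structure.RelMap (M := TermModel hΔ) R (fun i => TermModel.mk hΔ (g i) (hg i)) ↔
      rel (Encodable.encode (⟨n, R⟩ : Σ i, L.Relations i)) (PreTerm.ofFn g) ∈ Δ := by
  show rel _ _ ∈ Δ ↔ _
  constructor
  · exact hΔ.rel_congr _ (fun i => (((TermModel.mk hΔ (g i) (hg i)).rep hΔ).2).closedTerm_of_zero)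
      (fun i => (hg i).closedTerm_of_zero) (fun i => TermModel.rep_mk_equal hΔ (g i) (hg i))
  · exact hΔ.rel_congr _ (fun i => (hg i).closedTerm_of_zero)
      (fun i => (((TermModel.mk hΔ (g i) (hg i)).rep hΔ).2).closedTerm_of_zero)
      (fun i => hΔ.equal_symm (((TermModel.mk hΔ (g i) (hg i)).rep hΔ).2).closedTerm_of_zero
        (hg i).closedTerm_of_zero (TermModel.rep_mk_equal hΔ (g i) (hg i)))

/-- **Evaluation in the term model** (Enderton §2.5, Step 4, `s(t) = [t]`): a closed well-formed
term evaluates to its class, and a well-formed argument list of closed terms to the list of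
classes. [folklore] -/
theorem TermModel.eval_eq :
    ∀ (t : PreTerm) (xs : List (TermModel (L := L) hΔ)),
      (∀ h : t.Wf (arityF L) 0 none, (t.eval L (TermModel.κ hΔ) xs).1 = TermModel.mk hΔ t h) ∧
      (∀ n (_ : t.Wf (arityF L) 0 (some n)), ∃ g : Fin n → PreTerm, ∃ hg : ∀ i, (g i).Wf (arityF L) 0 none,
        t = PreTerm.ofFn g ∧ (t.eval L (TermModel.κ hΔ) xs).2 = List.ofFn fun i => TermModel.mk hΔ (g i) (hg i))
  | PreTerm.var i, xs => by
      refine ⟨fun h => ?_, fun n h => ?_⟩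
      · cases h with | var hi => exact absurd hi (Nat.not_lt_zero _)
      · cases h
  | PreTerm.param c, xs => by
      refine ⟨fun h => rfl, fun n h => ?_⟩
      cases h
  | PreTerm.func f args, xs => by
      refine ⟨fun h => ?_, fun n h => ?_⟩
      · cases h with
        | func hf ha =>
          obtain ⟨g, hg, rfl, hev⟩ := (TermModel.eval_eq args xs).2 _ ha
          obtain ⟨F, rfl⟩ := arityF_eq_some_iff.1 hf
          simp only [PreTerm.eval, hev, applyFun, Encodable.encodek, List.length_ofFn, ↓reduceIte,
            env_ofFn]
          rw [TermModel.funMap_mk]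
      · cases h
  | PreTerm.nil, xs => by
      refine ⟨fun h => ?_, fun n h => ?_⟩
      · cases h
      · cases h
        exact ⟨Fin.elim0, fun i => i.elim0, rfl, by simp [PreTerm.eval]⟩
  | PreTerm.cons t rest, xs => by
      refine ⟨fun h => ?_, fun n h => ?_⟩
      · cases h
      cases h with
      | cons ht hr =>
        obtain ⟨g, hg, rfl, hev⟩ := (TermModel.eval_eq rest xs).2 _ hr
        have het := (TermModel.eval_eq t xs).1 ht
        refine ⟨Fin.cons t g, Fin.cases ht hg, by simp [PreTerm.ofFn_succ], ?_⟩
        simp only [PreTerm.eval, het, hev, List.ofFn_succ, Fin.cons_zero, Fin.cons_succ]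

/-- Evaluation of a closed well-formed term in the term model. [folklore] -/
theorem TermModel.eval_fst (t : PreTerm) (h : t.Wf (arityF L) 0 none) (xs : List (TermModel (L := L) hΔ)) :
    (t.eval L (TermModel.κ hΔ) xs).1 = TermModel.mk hΔ t h :=
  (TermModel.eval_eq hΔ t xs).1 h

/-- **Truth lemma** (Enderton §2.5, Steps 4–5): for a well-formed pre-formula `φ` of depth `k`
and closed well-formed terms `σ 0, …, σ (k-1)`, the sentence `close k σ φ` belongs to the maximal
consistent Henkin set `Δ` iff it holds in the term model. [folklore] -/
theorem MaxCons.mem_iff_realize :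
    ∀ (φ : PreFormula) (k : ℕ) (σ : ℕ → PreTerm), (∀ i < k, (σ i).Wf (arityF L) 0 none) →
      φ.Wf (arityF L) (arityR L) k →
      (φ.close k σ ∈ Δ ↔ (φ.close k σ).Realize L (TermModel.κ hΔ) ([] : List (TermModel (L := L) hΔ)))
  | falsum, k, σ, hσ, _ => by
      simp only [PreFormula.close, PreFormula.Realize, iff_false]
      exact hΔ.falsum_notMem
  | equal t₁ t₂, k, σ, hσ, h => by
      cases h with
      | equal h₁ h₂ =>
        have h₁' : (t₁.close k σ).Wf (arityF L) 0 none := h₁.close hσ (j := 0)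
        have h₂' : (t₂.close k σ).Wf (arityF L) 0 none := h₂.close hσ (j := 0)
        simp only [PreFormula.close, PreFormula.Realize, TermModel.eval_fst hΔ _ h₁',
          TermModel.eval_fst hΔ _ h₂', TermModel.mk_eq_mk]
  | rel r args, k, σ, hσ, h => by
      cases h with
      | rel hr ha =>
        have ha' : (args.close k σ).Wf (arityF L) 0 (some _) := ha.close hσ (j := 0)
        obtain ⟨R, rfl⟩ := arityR_eq_some_iff.1 hr
        obtain ⟨g, hg, hga, hev⟩ := (TermModel.eval_eq hΔ (args.close k σ) []).2 _ ha'
        simp only [PreFormula.close, PreFormula.Realize]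
        rw [hga] at hev ⊢
        simp only [hev, HoldsRel, Encodable.encodek, List.length_ofFn, true_and, env_ofFn]
        rw [TermModel.relMap_mk]
  | imp φ ψ, k, σ, hσ, h => by
      cases h with
      | imp h₁ h₂ =>
        simp only [PreFormula.close, PreFormula.Realize]
        rw [hΔ.imp_mem_iff, MaxCons.mem_iff_realize φ k σ hσ h₁, MaxCons.mem_iff_realize ψ k σ hσ h₂]
  | all ψ, k, σ, hσ, h => by
      cases h with
      | all h₁ =>
        simp only [PreFormula.close, PreFormula.Realize, List.nil_append]
        have hσc : ∀ i < k, (σ i).closed = true := fun i hi => (hσ i hi).closed_of_zero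
        rw [hΔ.all_mem_iff (fun s => s.Wf (arityF L) 0 none) (fun s hs => hs.closedTerm_of_zero)
          (fun c => PreTerm.Wf.param c)]
        have hstep : ∀ (s : PreTerm) (hs : s.Wf (arityF L) 0 none),
            ((ψ.close k σ).inst 0 s ∈ Δ ↔
              (ψ.close k σ).Realize L (TermModel.κ hΔ) [TermModel.mk hΔ s hs]) := by
          intro s hs
          have hσ' : ∀ i < k + 1, (PreTerm.snocAt k σ s i).Wf (arityF L) 0 none := by
            intro i hi
            by_cases hik : i = k
            · subst hik; simpa using hs
            · rw [PreTerm.snocAt_of_lt σ s (by omega)]; exact hσ i (by omega)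
          rw [PreFormula.inst_close k σ s hσc, MaxCons.mem_iff_realize ψ (k + 1) _ hσ' h₁,
            ← PreFormula.inst_close k σ s hσc, realize_inst_zero _ hs.closedTerm_of_zero,
            TermModel.eval_fst hΔ s hs]
        constructor
        · intro hall a
          obtain ⟨s, hs, rfl⟩ := TermModel.exists_mk hΔ a
          exact (hstep s hs).1 (hall s hs)
        · intro hall s hs
          exact (hstep s hs).2 (hall _)

/-- Truth lemma for sentences: a well-formed pre-sentence is in `Δ` iff it holds in the term
model. [folklore] -/
theorem MaxCons.mem_iff_realize_sentence {φ : PreFormula} (h : φ.Wf (arityF L) (arityR L) 0) :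
    φ ∈ Δ ↔ φ.Realize L (TermModel.κ hΔ) ([] : List (TermModel (L := L) hΔ)) := by
  have := MaxCons.mem_iff_realize hΔ φ 0 (fun _ => PreTerm.param 0) (fun i hi => absurd hi (Nat.not_lt_zero _)) h
  simpa only [PreFormula.close_zero] using this

end TermModel

/-! ### Step 6: completeness -/

section Completeness

variable {L : Language} [Encodable (Σ i, L.Functions i)] [Encodable (Σ i, L.Relations i)]

/-- **Soundness and completeness of the Hilbert calculus** (Gödel 1930; Enderton §2.5,
Soundness Theorem and Completeness Theorem, proof by Henkin's method): a sentence `φ` of a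
language with encodable symbols is derivable from (translations of) members of `T` in the calculus
`Derives` iff `T ⊨ᵇ φ` in Mathlib's sense (all models in `Type (max u v)`, transferred to the
countable term model by `Theory.Model.isSatisfiable`). [cite: Enderton2001, §2.5 Completeness Theorem] -/
theorem provable_iff_models {T : L.Theory} {φ : L.Sentence} :
    Provable (PreFormula.ofBounded '' (T : Set L.Sentence)) (PreFormula.ofBounded φ) ↔ T ⊨ᵇ φ := by
  constructor
  · intro h
    rw [Theory.models_sentence_iff]
    intro M
    have hκ := h.sound (L := L) (M := M) (fun _ => Classical.ofNonempty) (fun ψ hψ => by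
      obtain ⟨χ, hχ, rfl⟩ := hψ
      exact (realize_ofBounded_sentence _ χ).2 (Theory.realize_sentence_of_mem T hχ))
    exact (realize_ofBounded_sentence _ φ).1 hκ
  · intro h
    by_contra hP
    -- the consistent, parameter-free, well-formed set S = T ∪ {¬φ}
    set S : Set PreFormula := insert (PreFormula.not (PreFormula.ofBounded φ))
      (PreFormula.ofBounded '' (T : Set L.Sentence)) with hSdef
    have hS : Consistent S := Consistent.insert_not hP
    have hS0 : ∀ ψ ∈ S, ψ.params = ∅ := by
      intro ψ hψ
      rcases Set.mem_insert_iff.1 hψ with rfl | ⟨χ, _, rfl⟩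
      · simp [PreFormula.params, params_ofBounded]
      · exact params_ofBounded χ
    have hSwf : ∀ ψ ∈ S, ψ.Wf (arityF L) (arityR L) 0 := by
      intro ψ hψ
      rcases Set.mem_insert_iff.1 hψ with rfl | ⟨χ, _, rfl⟩
      · exact Wf.imp (Wf.ofBounded φ) Wf.falsum
      · exact Wf.ofBounded χ
    obtain ⟨Δ, hHΔ, hΔc, hΔm⟩ := exists_maximal (consistent_henkinSet hS hS0)
    have hΔ : MaxCons Δ := ⟨hΔc, hΔm, fun n => hHΔ (Or.inr ⟨n, rfl⟩)⟩
    have hSΔ : S ⊆ Δ := fun ψ hψ => hHΔ (Or.inl hψ)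
    -- the term model satisfies T and ¬φ
    let M := TermModel (L := L) hΔ
    have hT : (T : L.Theory).Model M := by
      refine ⟨fun χ hχ => ?_⟩
      have hmem : PreFormula.ofBounded χ ∈ Δ := hSΔ (Set.mem_insert_of_mem _ ⟨χ, hχ, rfl⟩)
      exact (realize_ofBounded_sentence (TermModel.κ hΔ) χ).1
        ((hΔ.mem_iff_realize_sentence (Wf.ofBounded χ)).1 hmem)
    have hnφ : ¬ M ⊨ φ := by
      intro hφ
      have hmem : PreFormula.not (PreFormula.ofBounded φ) ∈ Δ := hSΔ (Set.mem_insert _ _)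
      have := (hΔ.mem_iff_realize_sentence
        (Wf.imp (Wf.ofBounded φ) Wf.falsum)).1 hmem
      exact this ((realize_ofBounded_sentence (TermModel.κ hΔ) φ).2 hφ)
    have hsat : Theory.IsSatisfiable (T ∪ {Formula.not φ}) := by
      have : (T ∪ {Formula.not φ}).Model M := by
        rw [Theory.model_union_iff, Theory.model_singleton_iff]
        exact ⟨hT, (Sentence.realize_not M).2 hnφ⟩
      exact Theory.Model.isSatisfiable M
    exact (Theory.models_iff_not_satisfiable φ).1 h hsat

end Completeness

end Literature.ModelTheory.ProofTheory.PreFOL
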